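import Literature.NumberTheory.Rogawski1990.RankOneTorusStablePartner                  -- ★ F0P2-p01 (g10): `formCongr_diagonal_antidiagTwo`, `isLocalStablyConjH_partnerCongr_not_isConj` (the partner `(Ad diag(1,r), id)`)
import Literature.NumberTheory.Rogawski1990.LocalStableClassesRankTwoCompactSideCount     -- ★ B-p04 (g34): `eigenframe_trichotomy_of_separable`, `exists_twoClasses_of_eigenframe`, `isConj_of_isLocalStablyConjH_of_split∕_of_not_exists_isRoot`
import Literature.NumberTheory.Automorphic.LocalEndoscopicOrbitClosed                    -- ★ `isGRegular_of_isStablyConjH`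
import HarnessLib

/-!
# The STABLE TWIST AUTOMORPHISM of `H_v = U(Φ₂)(L⁺_v) × U(Φ₁)(L⁺_v)` at a non-split place: a bicontinuous automorphism `e` with INNER SQUARE,
# `e a` stably conjugate to `a`, and `{⟦a⟧, ⟦e a⟧}` = the whole `H_v`-stable class of every `G`-regular `a`
(Rogawski 1990, §3.5 Prop. 3.5.2 (c) p. 29, §3.6 pp. 31–32 «the conjugacy classes within a stable class are parametrised by `𝔇(T∕F)`»; §12.5 p. 182)

Topic `NumberTheory/Rogawski1990`; namespace `Literature.NumberTheory.Rogawski1990`.  THEOREMS ONLY (no definition, no instance, no notation, no named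
fact, no `sorry`).  Cell `pub/hodgecm-mathlib`, crux H413 = stmt-HodgeConjecture-24833, ROAD «UP-TR» (holder F0P3-p02 (g23), `F0/P3/F0P3-p02/g23/ROAD-UP-TR.v2.F0P3p02g23.md`
§B brick **(H6a′) TWIST-MAPS**, FILE 2∕3; hand F0P3a-p09 (g11)).  HONEST LABEL: count-neutral; HC_CM is proved only modulo the printed citations until rung 0 closes.

THE MATHEMATICS.  Print indexes the `H`-classes inside the stable class of a regular `s ∈ T_H(F)` by `𝔇(T_H∕F) = ker(H¹(F,T_H) → H¹(F,H))`, of order `1` or `2`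
for `H = U(1,1) × U(1)` [§3.6].  In the tree's cohomology-free currency the non-trivial twist is ONE GLOBAL AUTOMORPHISM of `H_v`: the similitude
`T_r = diag(1, r)` of `Φ₂ = antidiag(1,1)` with a `σ`-fixed NON-NORM multiplier `r` (★ `RankOneTorusStablePartner`) gives `e := (Ad T_r, id) : H_v ≃ₜ* H_v` with
* `e a` STABLY CONJUGATE to `a` for every `a` (`T_r ∈ GL₂(L_w)` is a stable conjugator; the `U(Φ₁)`-components agree);
* `e ∘ e = Ad u` INNER, `u = (diag(r⁻¹, r), 1) ∈ H_v` (`T_r² = r · diag(r⁻¹, r)` and scalars act trivially) — so `e(e(T_H)) = u T_H u⁻¹` for every Cartan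
  `T_H` («`T** ∼_H T`»), `e` preserves every two-sided Haar measure (★ `Literature.MeasureTheory.Group.measurePreserving_of_forall_apply_apply_eq_conj`,
  FILE 1), and `[N_H(e T_H) : e T_H] = [N_H(T_H) : T_H]` (any automorphism);
* `e` preserves `G`-regularity (a stable-class function, ★ `isGRegular_of_isStablyConjH`);
* for `a` of EIGENFRAME TYPE (`a.1 P = P diag(d)`, `σ(dᵢ)dᵢ = 1`, `a.1` regular) `e a` is NOT conjugate to `a` (★ `isLocalStablyConjH_partnerCongr_not_isConj`);
* for EVERY `G`-regular `a`: every stable conjugate of `a` is conjugate to `a` or to `e a`, i.e. `{c | a ∼_st c.out} = {⟦a⟧, ⟦e a⟧}` — the pair of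
  [Prop. 3.5.2 (c)] in eigenframe type (★ `exists_twoClasses_of_eigenframe`), and the singleton `{⟦a⟧} = {⟦a⟧, ⟦e a⟧}` in the split ∕ irreducible
  types (★ `isConj_of_isLocalStablyConjH_of_split` ∕ `…_of_not_exists_isRoot`, via ★ `eigenframe_trichotomy_of_separable`).
So the road's twist family `Tw(T_H) ⊂ {id, e|_{T_H}}` consists of restrictions of automorphisms of `H_v` (FILE 3 adds the Haar clause and the per-Cartan dichotomy).

* **`exists_stableTwistAut`** — the seven clauses above for ONE `e` and ONE `u` (CM dress, non-split `v`).  The GENERIC transport facts an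
  automorphism with inner square affords (`e(Z(γ)) = Z(e γ)` ★ `Literature.GroupTheory.map_centralizer_singleton_mulEquiv`; `[N(Z(eγ)):Z(eγ)] = [N(Z(γ)):Z(γ)]`,
  `Z(e(eγ)) = u Z(γ) u⁻¹`, the restricted `Z(γ) ≃ₜ* Z(eγ)` — ★ `Literature/GroupTheory/MulEquivCentralizerTransport` (F0P3b-p01 (g20), brick (α))) are NOT restated here;
  the Haar clause and the per-Cartan dichotomy are FILE 3 (`EndoscopicStableTwistFamily`).

## References
* [Rogawski1990] J. D. Rogawski, *Automorphic Representations of Unitary Groups in Three Variables*, Ann. of Math. Stud. 123 (1990), §3.1 p. 19,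
  §3.5 Prop. 3.5.2 (c) p. 29, §3.6 pp. 31–32, §4.3 p. 42, §12.5 p. 182.
* [LabesseLanglands1979] J.-P. Labesse, R. P. Langlands, *L-indistinguishability for SL(2)*, Canad. J. Math. 31 (1979), §2.
* [PlatonovRapinchuk1994] V. Platonov, A. Rapinchuk, *Algebraic Groups and Number Theory* (1994), §2.3.
-/

set_option autoImplicit false

noncomputable section

open NumberField IsDedekindDomain Matrix
open scoped MatrixGroups

namespace Literature.NumberTheory.Rogawski1990

open Literature.NumberTheory.Automorphic Literature.NumberTheory.Automorphic.UnitaryGroup Literature.NumberTheory.GaloisRepresentations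
open Literature.AlgebraicGeometry.ShimuraVarieties (unitaryGroup mem_unitaryGroup_iff)

/-! ## The stable twist automorphism `e = (Ad diag(1, r), id)` of `H_v`, `r` a `σ`-fixed non-norm -/

/-- `diag(a, b)` is `τ`-unitary for `antidiag(1, 1)` when `τ(a) b = τ(b) a = 1` (the element `diag(r⁻¹, r)`, `τ r = r`). [cite: Rogawski1990, §1.9 p. 8] -/
private theorem diagonal_mem_unitary_antidiag_aux {R : Type*} [CommRing R] (τ : R →+* R) (a b : R) (h1 : τ a * b = 1) (h2 : τ b * a = 1) :
    ((Matrix.diagonal ![a, b]).map τ)ᵀ * (Matrix.of fun i j : Fin 2 => if i.val + j.val + 1 = 2 then (1 : R) else 0) * Matrix.diagonal ![a, b] =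
      Matrix.of fun i j : Fin 2 => if i.val + j.val + 1 = 2 then (1 : R) else 0 := by
  ext i j : 1
  fin_cases i <;> fin_cases j <;>
    simp [Matrix.mul_apply, Fin.sum_univ_two, Matrix.diagonal, Matrix.map_apply, Matrix.transpose_apply, Matrix.of_apply, h1, h2]

section CM

variable (L : Type) [Field L] [NumberField L] [IsCMField L] (v : HeightOneSpectrum (𝓞 ↥(maximalRealSubfield L)))

omit [IsCMField L] in
/-- `Φ₂` pushed to `L ⊗ L⁺_v` is `antidiag(1,1)` (local copy of the private ★ `antidiagTwo_map_algebraMap₁₀`). [cite: Rogawski1990, §1.9 p. 8] -/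
private theorem antidiagTwo_map_algebraMap_twist :
    (Matrix.of fun i j : Fin 2 => if i.val + j.val + 1 = 2 then (1 : L) else 0).map (algebraMap L (LocalRing L v)) = Matrix.of fun i j : Fin 2 => if i.val + j.val + 1 = 2 then (1 : (LocalRing L v)) else 0 := by
  ext i j
  simp only [map_apply, of_apply]
  split_ifs <;> simp

/-- `a ∈ Z(a)`. [folklore] -/
private theorem mem_centralizer_singleton_self {M : Type*} [Group M] (a : M) : a ∈ Subgroup.centralizer ({a} : Set M) :=
  Subgroup.mem_centralizer_iff.2 fun b hb => by rw [Set.mem_singleton_iff.1 hb]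

/-! ### The clauses, one lemma each (the automorphism `e` enters through its defining equation `he`) -/

section Clauses

variable {L v}
variable (w : PlacesOver L v) (hw : IsCMField.complexConj L • w.1 = w.1) {r : (LocalRing L v)} (hru : IsUnit r) (hrσ : (conjLocal L (IsCMField.complexConj L) v) r = r)
  {e : ((cmDatum L 2 (Matrix.of fun i j : Fin 2 => if i.val + j.val + 1 = 2 then (1 : L) else 0)).Local v × (cmDatum L 1 (Matrix.of fun i j : Fin 1 => if i.val + j.val + 1 = 1 then (1 : L) else 0)).Local v) ≃ₜ* ((cmDatum L 2 (Matrix.of fun i j : Fin 2 => if i.val + j.val + 1 = 2 then (1 : L) else 0)).Local v × (cmDatum L 1 (Matrix.of fun i j : Fin 1 => if i.val + j.val + 1 = 1 then (1 : L) else 0)).Local v)} (he : ∀ a : ((cmDatum L 2 (Matrix.of fun i j : Fin 2 => if i.val + j.val + 1 = 2 then (1 : L) else 0)).Local v × (cmDatum L 1 (Matrix.of fun i j : Fin 1 => if i.val + j.val + 1 = 1 then (1 : L) else 0)).Local v), e a = ((cmDatumLocalCongr L v (glDiagonal 2 (LocalRing L v) ![1, hru.unit]) hru (formCongr_diagonal_antidiagTwo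 L v hru hrσ)) a.1, a.2))

include he in
/-- `e` is the identity on the `U(Φ₁)`-component. [cite: Rogawski1990, §3.6 pp. 31–32] -/
private theorem twist_snd (a : ((cmDatum L 2 (Matrix.of fun i j : Fin 2 => if i.val + j.val + 1 = 2 then (1 : L) else 0)).Local v × (cmDatum L 1 (Matrix.of fun i j : Fin 1 => if i.val + j.val + 1 = 1 then (1 : L) else 0)).Local v)) : (e a).2 = a.2 := by rw [he]

include he in
/-- `(e a).1 = T_r a.1 T_r⁻¹` in `GL₂`. [cite: PlatonovRapinchuk1994, §2.3] -/
private theorem twist_val (a : ((cmDatum L 2 (Matrix.of fun i j : Fin 2 => if i.val + j.val + 1 = 2 then (1 : L) else 0)).Local v × (cmDatum L 1 (Matrix.of fun i j : Fin 1 => if i.val + j.val + 1 = 1 then (1 : L) else 0)).Local v)) : (e a).1.val = (glDiagonal 2 (LocalRing L v) ![1, hru.unit]) * a.1.val * (glDiagonal 2 (LocalRing L v) ![1, hru.unit])⁻¹ := by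
  rw [he]; exact coe_cmDatumLocalCongr_apply L v _ hru (formCongr_diagonal_antidiagTwo L v hru hrσ) a.1

include he in
/-- `e a` is stably conjugate to `a`. [cite: Rogawski1990, §3.1 p. 19; §3.6 pp. 31–32] -/
private theorem twist_isLocalStablyConjH (a : ((cmDatum L 2 (Matrix.of fun i j : Fin 2 => if i.val + j.val + 1 = 2 then (1 : L) else 0)).Local v × (cmDatum L 1 (Matrix.of fun i j : Fin 1 => if i.val + j.val + 1 = 1 then (1 : L) else 0)).Local v)) : IsLocalStablyConjH L v a (e a) := by
  show IsStablyConj _ _ _ _ ∧ IsStablyConj _ _ _ _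
  rw [twist_snd hru hrσ he a]
  exact ⟨isStablyConj_iff.2 ⟨_, (twist_val hru hrσ he a).symm⟩, IsStablyConj.refl _⟩

include he in
/-- `e` preserves `G`-regularity. [cite: Rogawski1990, §4.3 p. 42] -/
private theorem twist_isLocalGRegular_iff (a : ((cmDatum L 2 (Matrix.of fun i j : Fin 2 => if i.val + j.val + 1 = 2 then (1 : L) else 0)).Local v × (cmDatum L 1 (Matrix.of fun i j : Fin 1 => if i.val + j.val + 1 = 1 then (1 : L) else 0)).Local v)) : IsLocalGRegular L v (e a) ↔ IsLocalGRegular L v a :=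
  ⟨fun h => isGRegular_of_isStablyConjH _ _ _ _ (twist_isLocalStablyConjH hru hrσ he a).symm h,
    fun h => isGRegular_of_isStablyConjH _ _ _ _ (twist_isLocalStablyConjH hru hrσ he a) h⟩

include hrσ in
/-- `diag(r⁻¹, r) ∈ U(Φ₂)(L⁺_v)` (`σ r = r`). [cite: Rogawski1990, §1.9 p. 8] -/
private theorem diag_inv_self_mem_local : (glDiagonal 2 (LocalRing L v) ![hru.unit⁻¹, hru.unit]) ∈ «local» L (IsCMField.complexConj L) 2 (Matrix.of fun i j : Fin 2 => if i.val + j.val + 1 = 2 then (1 : L) else 0) v := by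
  refine (mem_unitaryGroupOfForm_iff (σ := (conjLocal L (IsCMField.complexConj L) v)) (J := ((adelicForm L 2 (Matrix.of fun i j : Fin 2 => if i.val + j.val + 1 = 2 then (1 : L) else 0)).map (adeleToLocal L v))) (g := (glDiagonal 2 (LocalRing L v) ![hru.unit⁻¹, hru.unit]))).2 ?_
  have hr1 : ((hru.unit : (LocalRing L v)ˣ) : (LocalRing L v)) = r := hru.unit_spec
  have hrr : r * ((hru.unit⁻¹ : (LocalRing L v)ˣ) : (LocalRing L v)) = 1 := hru.mul_val_inv
  have hrr' : ((hru.unit⁻¹ : (LocalRing L v)ˣ) : (LocalRing L v)) * r = 1 := hru.val_inv_mul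
  have hσinv : (conjLocal L (IsCMField.complexConj L) v) ((hru.unit⁻¹ : (LocalRing L v)ˣ) : (LocalRing L v)) = ((hru.unit⁻¹ : (LocalRing L v)ˣ) : (LocalRing L v)) := by
    calc (conjLocal L (IsCMField.complexConj L) v) ((hru.unit⁻¹ : (LocalRing L v)ˣ) : (LocalRing L v)) = (conjLocal L (IsCMField.complexConj L) v) ((hru.unit⁻¹ : (LocalRing L v)ˣ) : (LocalRing L v)) * (r * ((hru.unit⁻¹ : (LocalRing L v)ˣ) : (LocalRing L v))) := by rw [hrr, mul_one]
      _ = (conjLocal L (IsCMField.complexConj L) v) (((hru.unit⁻¹ : (LocalRing L v)ˣ) : (LocalRing L v)) * r) * ((hru.unit⁻¹ : (LocalRing L v)ˣ) : (LocalRing L v)) := by rw [map_mul, hrσ, mul_assoc]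
      _ = ((hru.unit⁻¹ : (LocalRing L v)ˣ) : (LocalRing L v)) := by rw [hrr', map_one, one_mul]
  have hvec : (fun k : Fin 2 => ((![hru.unit⁻¹, hru.unit] k : (LocalRing L v)ˣ) : (LocalRing L v))) = ![((hru.unit⁻¹ : (LocalRing L v)ˣ) : (LocalRing L v)), r] := by
    funext k
    fin_cases k
    · rfl
    · exact hr1
  rw [adelicForm_map_adeleToLocal, antidiagTwo_map_algebraMap_twist L v, coe_glDiagonal, hvec]
  exact diagonal_mem_unitary_antidiag_aux (conjLocal L (IsCMField.complexConj L) v) _ _ (by rw [hσinv]; exact hrr') (by rw [hrσ]; exact hrr)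

omit [IsCMField L] in
/-- `T_r · T_r = (r · 1) · diag(r⁻¹, r)` in `GL₂`. [cite: PlatonovRapinchuk1994, §2.3] -/
private theorem twistMatrix_mul_self : (glDiagonal 2 (LocalRing L v) ![1, hru.unit]) * (glDiagonal 2 (LocalRing L v) ![1, hru.unit]) = (glDiagonal 2 (LocalRing L v) (fun _ => hru.unit)) * (glDiagonal 2 (LocalRing L v) ![hru.unit⁻¹, hru.unit]) := by
  rw [← map_mul, ← map_mul]
  congr 1
  funext k
  fin_cases k
  · simp
  · simp

omit [IsCMField L] in
/-- Scalar matrices are central in `GL₂`. [folklore] -/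
private theorem scalar_glDiagonal_comm (Y : GL (Fin 2) (LocalRing L v)) : (glDiagonal 2 (LocalRing L v) (fun _ => hru.unit)) * Y = Y * (glDiagonal 2 (LocalRing L v) (fun _ => hru.unit)) := by
  apply Units.ext
  rw [Units.val_mul, Units.val_mul, coe_glDiagonal, ← Matrix.smul_one_eq_diagonal, Matrix.smul_mul, Matrix.one_mul, Matrix.mul_smul, Matrix.mul_one]

include he in
/-- **INNER SQUARE**: `e (e a) = u a u⁻¹`, `u = (diag(r⁻¹, r), 1)`. [cite: Rogawski1990, §3.6 pp. 31–32] -/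
private theorem twist_twist (hD : (glDiagonal 2 (LocalRing L v) ![hru.unit⁻¹, hru.unit]) ∈ «local» L (IsCMField.complexConj L) 2 (Matrix.of fun i j : Fin 2 => if i.val + j.val + 1 = 2 then (1 : L) else 0) v) (a : ((cmDatum L 2 (Matrix.of fun i j : Fin 2 => if i.val + j.val + 1 = 2 then (1 : L) else 0)).Local v × (cmDatum L 1 (Matrix.of fun i j : Fin 1 => if i.val + j.val + 1 = 1 then (1 : L) else 0)).Local v)) :
    e (e a) = ((⟨(glDiagonal 2 (LocalRing L v) ![hru.unit⁻¹, hru.unit]), hD⟩, 1) : ((cmDatum L 2 (Matrix.of fun i j : Fin 2 => if i.val + j.val + 1 = 2 then (1 : L) else 0)).Local v × (cmDatum L 1 (Matrix.of fun i j : Fin 1 => if i.val + j.val + 1 = 1 then (1 : L) else 0)).Local v)) * a * ((⟨(glDiagonal 2 (LocalRing L v) ![hru.unit⁻¹, hru.unit]), hD⟩, 1) : ((cmDatum L 2 (Matrix.of fun i j : Fin 2 => if i.val + j.val + 1 = 2 then (1 : L) else 0)).Local v × (cmDatum L 1 (Matrix.of fun i j : Fin 1 => if i.val + j.val + 1 =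 1 then (1 : L) else 0)).Local v))⁻¹ := by
  refine Prod.ext ?_ ?_
  · apply Subtype.ext
    show (e (e a)).1.val = (glDiagonal 2 (LocalRing L v) ![hru.unit⁻¹, hru.unit]) * a.1.val * (glDiagonal 2 (LocalRing L v) ![hru.unit⁻¹, hru.unit])⁻¹
    rw [twist_val hru hrσ he, twist_val hru hrσ he]
    calc (glDiagonal 2 (LocalRing L v) ![1, hru.unit]) * ((glDiagonal 2 (LocalRing L v) ![1, hru.unit]) * a.1.val * ((glDiagonal 2 (LocalRing L v) ![1, hru.unit]))⁻¹) * ((glDiagonal 2 (LocalRing L v) ![1, hru.unit]))⁻¹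
        = ((glDiagonal 2 (LocalRing L v) ![1, hru.unit]) * (glDiagonal 2 (LocalRing L v) ![1, hru.unit])) * a.1.val * ((glDiagonal 2 (LocalRing L v) ![1, hru.unit]) * (glDiagonal 2 (LocalRing L v) ![1, hru.unit]))⁻¹ := by group
      _ = ((glDiagonal 2 (LocalRing L v) (fun _ => hru.unit)) * (glDiagonal 2 (LocalRing L v) ![hru.unit⁻¹, hru.unit])) * a.1.val * ((glDiagonal 2 (LocalRing L v) (fun _ => hru.unit)) * (glDiagonal 2 (LocalRing L v) ![hru.unit⁻¹, hru.unit]))⁻¹ := by rw [twistMatrix_mul_self hru]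
      _ = (glDiagonal 2 (LocalRing L v) (fun _ => hru.unit)) * ((glDiagonal 2 (LocalRing L v) ![hru.unit⁻¹, hru.unit]) * a.1.val * ((glDiagonal 2 (LocalRing L v) ![hru.unit⁻¹, hru.unit]))⁻¹) * ((glDiagonal 2 (LocalRing L v) (fun _ => hru.unit)))⁻¹ := by group
      _ = ((glDiagonal 2 (LocalRing L v) ![hru.unit⁻¹, hru.unit]) * a.1.val * ((glDiagonal 2 (LocalRing L v) ![hru.unit⁻¹, hru.unit]))⁻¹) * (glDiagonal 2 (LocalRing L v) (fun _ => hru.unit)) * ((glDiagonal 2 (LocalRing L v) (fun _ => hru.unit)))⁻¹ := by rw [scalar_glDiagonal_comm hru]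
      _ = (glDiagonal 2 (LocalRing L v) ![hru.unit⁻¹, hru.unit]) * a.1.val * ((glDiagonal 2 (LocalRing L v) ![hru.unit⁻¹, hru.unit]))⁻¹ := by group
  · show (e (e a)).2 = 1 * a.2 * 1⁻¹
    rw [twist_snd hru hrσ he, twist_snd hru hrσ he, inv_one, mul_one, one_mul]

include hw he in
/-- **Eigenframe type: `e a` is NOT conjugate to `a`** (★ `isLocalStablyConjH_partnerCongr_not_isConj` at `t₀ = t = a`). [cite: Rogawski1990, §3.5 Prop. 3.5.2 (c) p. 29] -/
private theorem twist_not_isConj (hrn : ¬ ∃ z : (LocalRing L v), IsUnit z ∧ r = (conjLocal L (IsCMField.complexConj L) v) z * z) (a : ((cmDatum L 2 (Matrix.of fun i j : Fin 2 => if i.val + j.val + 1 = 2 then (1 : L) else 0)).Local v × (cmDatum L 1 (Matrix.of fun i j : Fin 1 => if i.val + j.val + 1 = 1 then (1 : L) else 0)).Local v)) (P : GL (Fin 2) (LocalRing L v)) (d : Fin 2 → (LocalRing L v))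
    (ha : IsRegularElt (a.1.val : GL (Fin 2) (LocalRing L v))) (hP : (a.1.val.val : Matrix (Fin 2) (Fin 2) (LocalRing L v)) * P.val = P.val * Matrix.diagonal d)
    (hd1 : ∀ i, (conjLocal L (IsCMField.complexConj L) v) (d i) * d i = 1) : ¬ IsConj a (e a) := by
  have h := (isLocalStablyConjH_partnerCongr_not_isConj L v w hw hru hrσ hrn a P d ha hP hd1 ⟨a, mem_centralizer_singleton_self a⟩ ha).2
  rw [he]
  exact h

include hw he in
/-- **Exhaustion: every stable conjugate of a `G`-regular `a` is conjugate to `a` or to `e a`** (trichotomy ★ `eigenframe_trichotomy_of_separable`).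
[cite: Rogawski1990, §3.5 Prop. 3.5.2 (c) p. 29; §3.6 p. 31] -/
private theorem twist_exhaust (hrn : ¬ ∃ z : (LocalRing L v), IsUnit z ∧ r = (conjLocal L (IsCMField.complexConj L) v) z * z) (a : ((cmDatum L 2 (Matrix.of fun i j : Fin 2 => if i.val + j.val + 1 = 2 then (1 : L) else 0)).Local v × (cmDatum L 1 (Matrix.of fun i j : Fin 1 => if i.val + j.val + 1 = 1 then (1 : L) else 0)).Local v)) (ha : IsLocalGRegular L v a) (k : ((cmDatum L 2 (Matrix.of fun i j : Fin 2 => if i.val + j.val + 1 = 2 then (1 : L) else 0)).Local v × (cmDatum L 1 (Matrix.of fun i j : Fin 1 => if i.val + j.val + 1 = 1 then (1 : L) else 0)).Local v))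
    (hk : IsLocalStablyConjH L v a k) : IsConj a k ∨ IsConj (e a) k := by
  have hreg : IsRegularElt (a.1.val : GL (Fin 2) (LocalRing L v)) := (isRegularElt_fst_snd_of_isLocalGRegular L v a ha).1
  have hsep : (a.1.val : GL (Fin 2) (LocalRing L v)).val.charpoly.Separable := hreg
  rcases eigenframe_trichotomy_of_separable L v w hw (isUnit_det_adelicForm_antidiagTwo_local L v) a.1.2 hsep with
    ⟨P, d, hP, hd, hd1⟩ | ⟨P, d, hP, -, h0⟩ | hroot
  · obtain ⟨a', -, -, hall⟩ := exists_twoClasses_of_eigenframe L v w hw a hP hd hd1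
    rcases hall k hk with h | h
    · exact Or.inl h
    · rcases hall (e a) (twist_isLocalStablyConjH hru hrσ he a) with h' | h'
      · exact absurd h' (twist_not_isConj w hw hru hrσ he hrn a P d hreg hP hd1)
      · exact Or.inr (h'.symm.trans h)
  · exact Or.inl (isConj_of_isLocalStablyConjH_of_split L v w hw a hP h0 k hk)
  · exact Or.inl (isConj_of_isLocalStablyConjH_of_not_exists_isRoot L v w hw a hroot k hk)

include hw he in
/-- **The class set `{⟦a⟧, ⟦e a⟧}`** of a `G`-regular `a` (★ `setOf_st_out_eq_pair`). [cite: Rogawski1990, §3.5 Prop. 3.5.2 (c) p. 29; §3.6 p. 31] -/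
private theorem twist_classSet (hrn : ¬ ∃ z : (LocalRing L v), IsUnit z ∧ r = (conjLocal L (IsCMField.complexConj L) v) z * z) (a : ((cmDatum L 2 (Matrix.of fun i j : Fin 2 => if i.val + j.val + 1 = 2 then (1 : L) else 0)).Local v × (cmDatum L 1 (Matrix.of fun i j : Fin 1 => if i.val + j.val + 1 = 1 then (1 : L) else 0)).Local v)) (ha : IsLocalGRegular L v a) :
    {c : ConjClasses ((cmDatum L 2 (Matrix.of fun i j : Fin 2 => if i.val + j.val + 1 = 2 then (1 : L) else 0)).Local v × (cmDatum L 1 (Matrix.of fun i j : Fin 1 => if i.val + j.val + 1 = 1 then (1 : L) else 0)).Local v) | IsLocalStablyConjH L v a (Quotient.out c)} = {ConjClasses.mk a, ConjClasses.mk (e a)} := by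
  have hrefl : ∀ b : ((cmDatum L 2 (Matrix.of fun i j : Fin 2 => if i.val + j.val + 1 = 2 then (1 : L) else 0)).Local v × (cmDatum L 1 (Matrix.of fun i j : Fin 1 => if i.val + j.val + 1 = 1 then (1 : L) else 0)).Local v), IsConj a b → IsLocalStablyConjH L v a b := fun _ h => isStablyConjH_of_isConj h
  have hconj : ∀ (b y : ((cmDatum L 2 (Matrix.of fun i j : Fin 2 => if i.val + j.val + 1 = 2 then (1 : L) else 0)).Local v × (cmDatum L 1 (Matrix.of fun i j : Fin 1 => if i.val + j.val + 1 = 1 then (1 : L) else 0)).Local v)), IsLocalStablyConjH L v a b → IsLocalStablyConjH L v a (y * b * y⁻¹) :=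
    fun b y hb => hb.trans (isStablyConjH_of_isConj (isConj_iff.2 ⟨y, rfl⟩))
  exact setOf_st_out_eq_pair (IsLocalStablyConjH L v) a (e a) hrefl hconj (twist_isLocalStablyConjH hru hrσ he a)
    (twist_exhaust w hw hru hrσ he hrn a ha)

end Clauses

/-- **THE STABLE TWIST AUTOMORPHISM OF `H_v`.**  At a non-split place `v` (`w ∣ v`, `w̄ = w`) there are a topological-group automorphism
`e : H_v ≃ₜ* H_v` and an element `u ∈ H_v` such that: (1) `e` is the identity on the `U(Φ₁)`-component; (2) `e a` is STABLY CONJUGATE to `a` for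
every `a`; (3) `e (e a) = u a u⁻¹` (INNER SQUARE); (4) `e` preserves `G`-regularity; (5) for `a` with `a.1` regular of eigenframe type (`a.1 P = P diag(d)`,
`σ(dᵢ) dᵢ = 1`) `e a` is NOT conjugate to `a`; (6) for `G`-regular `a`, every stable conjugate of `a` is conjugate to `a` or to `e a`; (7) hence the set of
`H_v`-classes in the stable class of a `G`-regular `a` is `{⟦a⟧, ⟦e a⟧}` (a pair in eigenframe type, the singleton `{⟦a⟧}` otherwise).  Construction:
`e = (Ad T_r, id)`, `T_r = diag(1, r)`, `r` a `σ`-fixed non-norm unit (★ `exists_conjLocal_eq_not_exists_norm`), `u = (diag(r⁻¹, r), 1)`.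
[cite: Rogawski1990, §3.5 Prop. 3.5.2 (c) p. 29; §3.6 pp. 31–32; §4.3 p. 42] [cite: LabesseLanglands1979, §2] [cite: PlatonovRapinchuk1994, §2.3] -/
theorem exists_stableTwistAut (w : PlacesOver L v) (hw : IsCMField.complexConj L • w.1 = w.1) :
    ∃ (e : ((cmDatum L 2 (Matrix.of fun i j : Fin 2 => if i.val + j.val + 1 = 2 then (1 : L) else 0)).Local v × (cmDatum L 1 (Matrix.of fun i j : Fin 1 => if i.val + j.val + 1 = 1 then (1 : L) else 0)).Local v) ≃ₜ* ((cmDatum L 2 (Matrix.of fun i j : Fin 2 => if i.val + j.val + 1 = 2 then (1 : L) else 0)).Local v × (cmDatum L 1 (Matrix.of fun i j : Fin 1 => if i.val + j.val + 1 = 1 then (1 : L) else 0)).Local v)) (u : ((cmDatum L 2 (Matrix.of fun i j : Fin 2 => if i.val + j.val + 1 = 2 then (1 : L) else 0)).Local v × (cmDatum L 1 (Matrix.of fun i j : Fin 1 => if i.val + j.val + 1 = 1 then (1 : L) else 0)).Local v)),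
      (∀ a : ((cmDatum L 2 (Matrix.of fun i j : Fin 2 => if i.val + j.val + 1 = 2 then (1 : L) else 0)).Local v × (cmDatum L 1 (Matrix.of fun i j : Fin 1 => if i.val + j.val + 1 = 1 then (1 : L) else 0)).Local v), (e a).2 = a.2) ∧
      (∀ a : ((cmDatum L 2 (Matrix.of fun i j : Fin 2 => if i.val + j.val + 1 = 2 then (1 : L) else 0)).Local v × (cmDatum L 1 (Matrix.of fun i j : Fin 1 => if i.val + j.val + 1 = 1 then (1 : L) else 0)).Local v), IsLocalStablyConjH L v a (e a)) ∧
      (∀ a : ((cmDatum L 2 (Matrix.of fun i j : Fin 2 => if i.val + j.val + 1 = 2 then (1 : L) else 0)).Local v × (cmDatum L 1 (Matrix.of fun i j : Fin 1 => if i.val + j.val + 1 = 1 then (1 : L) else 0)).Local v), e (e a) = u * a * u⁻¹) ∧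
      (∀ a : ((cmDatum L 2 (Matrix.of fun i j : Fin 2 => if i.val + j.val + 1 = 2 then (1 : L) else 0)).Local v × (cmDatum L 1 (Matrix.of fun i j : Fin 1 => if i.val + j.val + 1 = 1 then (1 : L) else 0)).Local v), IsLocalGRegular L v (e a) ↔ IsLocalGRegular L v a) ∧
      (∀ (a : ((cmDatum L 2 (Matrix.of fun i j : Fin 2 => if i.val + j.val + 1 = 2 then (1 : L) else 0)).Local v × (cmDatum L 1 (Matrix.of fun i j : Fin 1 => if i.val + j.val + 1 = 1 then (1 : L) else 0)).Local v)) (P : GL (Fin 2) (LocalRing L v)) (d : Fin 2 → (LocalRing L v)), IsRegularElt (a.1.val : GL (Fin 2) (LocalRing L v)) →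
        (a.1.val.val : Matrix (Fin 2) (Fin 2) (LocalRing L v)) * P.val = P.val * Matrix.diagonal d → (∀ i, (conjLocal L (IsCMField.complexConj L) v) (d i) * d i = 1) → ¬ IsConj a (e a)) ∧
      (∀ a : ((cmDatum L 2 (Matrix.of fun i j : Fin 2 => if i.val + j.val + 1 = 2 then (1 : L) else 0)).Local v × (cmDatum L 1 (Matrix.of fun i j : Fin 1 => if i.val + j.val + 1 = 1 then (1 : L) else 0)).Local v), IsLocalGRegular L v a → ∀ k : ((cmDatum L 2 (Matrix.of fun i j : Fin 2 => if i.val + j.val + 1 = 2 then (1 : L) else 0)).Local v × (cmDatum L 1 (Matrix.of fun i j : Fin 1 => if i.val + j.val + 1 = 1 then (1 : L) else 0)).Local v), IsLocalStablyConjH L v a k → IsConj a k ∨ IsConj (e a) k) ∧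
      ∀ a : ((cmDatum L 2 (Matrix.of fun i j : Fin 2 => if i.val + j.val + 1 = 2 then (1 : L) else 0)).Local v × (cmDatum L 1 (Matrix.of fun i j : Fin 1 => if i.val + j.val + 1 = 1 then (1 : L) else 0)).Local v), IsLocalGRegular L v a →
        {c : ConjClasses ((cmDatum L 2 (Matrix.of fun i j : Fin 2 => if i.val + j.val + 1 = 2 then (1 : L) else 0)).Local v × (cmDatum L 1 (Matrix.of fun i j : Fin 1 => if i.val + j.val + 1 = 1 then (1 : L) else 0)).Local v) | IsLocalStablyConjH L v a (Quotient.out c)} = {ConjClasses.mk a, ConjClasses.mk (e a)} := by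
  classical
  obtain ⟨αg, hα0, hcα, -⟩ := cmQuadraticGenerator_spec L
  obtain ⟨r, hrσ, hru, hrn⟩ := exists_conjLocal_eq_not_exists_norm L v (IsCMField.complexConj L) hcα hα0 w hw
  have hsim := formCongr_diagonal_antidiagTwo L v hru hrσ
  -- the automorphism `e = (Ad T_r, id)`, `T_r = diag(1, r)` (kept abstract through `he`)
  obtain ⟨e, he⟩ : ∃ e : ((cmDatum L 2 (Matrix.of fun i j : Fin 2 => if i.val + j.val + 1 = 2 then (1 : L) else 0)).Local v × (cmDatum L 1 (Matrix.of fun i j : Fin 1 => if i.val + j.val + 1 = 1 then (1 : L) else 0)).Local v) ≃ₜ* ((cmDatum L 2 (Matrix.of fun i j : Fin 2 => if i.val + j.val + 1 = 2 then (1 : L) else 0)).Local v × (cmDatum L 1 (Matrix.of fun i j : Fin 1 => if i.val + j.val + 1 = 1 then (1 : L) else 0)).Local v), ∀ a : ((cmDatum L 2 (Matrix.of fun i j : Fin 2 => if i.val + j.val + 1 = 2 then (1 : L) else 0)).Local v × (cmDatum L 1 (Matrix.of fun i j : Fin 1 => if i.val + j.val + 1 = 1 then (1 : L) else 0)).Local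 v), e a = ((cmDatumLocalCongr L v (glDiagonal 2 (LocalRing L v) ![1, hru.unit]) hru (formCongr_diagonal_antidiagTwo L v hru hrσ)) a.1, a.2) :=
    ⟨{ toFun := fun a => ((cmDatumLocalCongr L v (glDiagonal 2 (LocalRing L v) ![1, hru.unit]) hru (formCongr_diagonal_antidiagTwo L v hru hrσ)) a.1, a.2)
       invFun := fun a => ((cmDatumLocalCongr L v (glDiagonal 2 (LocalRing L v) ![1, hru.unit]) hru (formCongr_diagonal_antidiagTwo L v hru hrσ)).symm a.1, a.2)
       left_inv := fun a => Prod.ext ((cmDatumLocalCongr L v (glDiagonal 2 (LocalRing L v) ![1, hru.unit]) hru (formCongr_diagonal_antidiagTwo L v hru hrσ)).symm_apply_apply a.1) rfl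
       right_inv := fun a => Prod.ext ((cmDatumLocalCongr L v (glDiagonal 2 (LocalRing L v) ![1, hru.unit]) hru (formCongr_diagonal_antidiagTwo L v hru hrσ)).apply_symm_apply a.1) rfl
       map_mul' := fun x y => Prod.ext (map_mul (cmDatumLocalCongr L v (glDiagonal 2 (LocalRing L v) ![1, hru.unit]) hru (formCongr_diagonal_antidiagTwo L v hru hrσ)) x.1 y.1) rfl
       continuous_toFun := ((cmDatumLocalCongr L v (glDiagonal 2 (LocalRing L v) ![1, hru.unit]) hru (formCongr_diagonal_antidiagTwo L v hru hrσ)).continuous.comp continuous_fst).prodMk continuous_snd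
       continuous_invFun := ((cmDatumLocalCongr L v (glDiagonal 2 (LocalRing L v) ![1, hru.unit]) hru (formCongr_diagonal_antidiagTwo L v hru hrσ)).symm.continuous.comp continuous_fst).prodMk continuous_snd }, fun a => rfl⟩
  have hD := diag_inv_self_mem_local hru hrσ
  exact ⟨e, ((⟨(glDiagonal 2 (LocalRing L v) ![hru.unit⁻¹, hru.unit]), hD⟩, 1) : ((cmDatum L 2 (Matrix.of fun i j : Fin 2 => if i.val + j.val + 1 = 2 then (1 : L) else 0)).Local v × (cmDatum L 1 (Matrix.of fun i j : Fin 1 => if i.val + j.val + 1 = 1 then (1 : L) else 0)).Local v)), twist_snd hru hrσ he, twist_isLocalStablyConjH hru hrσ he, twist_twist hru hrσ he hD,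
    twist_isLocalGRegular_iff hru hrσ he, twist_not_isConj w hw hru hrσ he hrn, twist_exhaust w hw hru hrσ he hrn, twist_classSet w hw hru hrσ he hrn⟩

end CM

end Literature.NumberTheory.Rogawski1990

end
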